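import Summits.QuantumFields.YangMills.Theorems.DiagonalMirrorRPRCubeSeamInterpolation
import Summits.QuantumFields.YangMills.Theorems.PencilRigidityWeakCouplingHypercubicLimitRPOfCubeDecoupling
import Summits.QuantumFields.YangMills.Theorems.DiagonalMirrorRPRSignTwistedCore
import HarnessLib

/-!
# Crux `WeakCouplingHypercubicLimitRP` (stmt-QuantumFields-27398), line `Sketch`, door C:
# `CubeDecoupling` — and the D1′ socket — from the quantitative letter `SeamInfluenceDecay` (the intended instance `R = L`)

Helper file (`--supports stmt-QuantumFields-27398 --as helper`) of the crux lead `lead-27398-D1` g3 (docket director-ym g24, O4 WORD 37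
internal plan (p2); typing prices idea-crit-9 g13 p-C1/p-C2/p-C3).  The composition below the located door-C letter:

* `abs_gramPairing_sub_cubeGramPairing_le` — at every step `k`, a uniform bound `ε` on the one-plaquette boundary influences of the seam of
  `Q_{R_k}` on the swap product `Y_k(F)(Σ·)·Y_k(F)(·)` gives `|gramPairing r sch F k − cubeGramPairing r sch R F k| ≤ #seam_k · ε`
  (✓`integral_wilson_sub_integral_cube` + ✓`gramPairing_eq_integral_famObs_swap` + ✓`cubeGramPairing_eq_integral_famObs_swap`);
* `card_seam_le` — `#seam ≤ 16 · S⁴` on the torus of side `S`;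
* ★ `cubeDecoupling_of_seamInfluenceDecay` — for the INTENDED EXTREME INSTANCE `R_k = L_k` (p-C3: only the plaquettes wrapping around the
  torus are deleted), `SeamInfluenceDecay r sch sch.L m` (`m > 0`) and the scheme clause `SideGrowth sch` (`a_k L_k / log a_k⁻¹ → ∞`) give
  `CubeDecoupling r sch sch.L`: `16 side_k⁴ · K a_k^{−P} e^{−m(a_k L_k − D)} → 0` (✓`tendsto_penalty_zero`);
* `admissibleCubeDecoupling_of_seamInfluenceDecay`, ★ `oddTorusSwapPairingLiminf_of_seamInfluenceDecay` — the D1′ socket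
  `OddTorusSwapPairingLiminf r sch` from `HasWeakCouplingLimit`, `SideGrowth`, `SeamInfluenceDecay r sch sch.L m`
  (✓p828702 `oddTorusSwapPairingLiminf_of_cubeDecoupling`, which uses the landed free-cube swap-RP `cubeHalfRP`);
* `stub_oddTorusSwapPairingLiminf_of_seamInfluenceDecay` — D1′'s exact binder list followed by `SideGrowth (subseq sch φ hφ)` and
  `SeamInfluenceDecay r (subseq sch φ hφ) (subseq sch φ hφ).L m` implies D1′'s conclusion BY NAME.

HONEST FRAMING: soft composition; the letter `SeamInfluenceDecay` (uniform-in-boundary-condition exponential decay of one-plaquette influences in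
physical units — wall W-loc) is NOT proved for non-abelian `G` at weak coupling and is the whole open content of door C; `SideGrowth` is a scheme
clause.  D1′, the crux ⟨27398⟩, its heart S6i and the summit are OPEN; the Yang–Mills mass gap is NOT proved here or anywhere in the tree.

References: Osterwalder–Seiler, Ann. Phys. 110 (1978) §3–4; Fröhlich–Israel–Lieb–Simon, CMP 62 (1978) Thm 2.1; Seiler, LNP 159 (1982) Ch. 2;
A. Adhikari, S. Cao, arXiv:2202.10375 Thm 1.
-/

set_option autoImplicit false

noncomputable section

open scoped SchwartzMap
open MeasureTheory Filter Topology
open Literature.MathematicalPhysics.QuantumLattice Literature.MathematicalPhysics.AQFT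
  Literature.MathematicalPhysics.QuantumFieldTheory
open Summit.QuantumFields.YangMills.Cruxes.HypercubicLimit.CouplingResponse
open Summit.QuantumFields.YangMills.Cruxes.DiagonalMirrorRPR.SignTwistedDiagonalTrace
open Summit.QuantumFields.YangMills.Cruxes.DiagonalMirrorRPR.SignTwistedDiagonalTrace.WilsonDiagonal (gramPairing_eq_integral_famObs_swap)
open Summit.QuantumFields.YangMills.Cruxes.DiagonalMirrorRPR.CubeSurgery
open Summit.QuantumFields.YangMills.Theorems.WeakCouplingHypercubicLimit.TraceNormColdPressure
  (oddTorusSwapPairingLiminf_of_cubeDecoupling oddTorusSwapPairingLiminf_subseq_of_cubeDecoupling)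

namespace Summit.QuantumFields.YangMills.Cruxes.DiagonalMirrorRPR.CubeSurgery

section Count

/-- The number of plaquettes of the torus of side `S` in dimension four is at most `16 S⁴`. [folklore] -/
theorem card_plaquette_le (S : ℕ) [NeZero S] : (Fintype.card (Plaquette 4 S) : ℝ) ≤ 16 * (S : ℝ) ^ 4 := by
  have h1 : Fintype.card (Plaquette 4 S) ≤ Fintype.card (Site 4 S) * Fintype.card (Fin 4 × Fin 4) := by
    rw [Fintype.card_prod]
    exact Nat.mul_le_mul_left _ (Fintype.card_subtype_le _)
  have h2 : Fintype.card (Site 4 S) = S ^ 4 := by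
    rw [Fintype.card_pi, Finset.prod_const, ZMod.card, Finset.card_univ, Fintype.card_fin]
  have h3 : Fintype.card (Fin 4 × Fin 4) = 16 := by simp
  rw [h2, h3] at h1
  have : (Fintype.card (Plaquette 4 S) : ℝ) ≤ ((S ^ 4 * 16 : ℕ) : ℝ) := by exact_mod_cast h1
  simpa [mul_comm] using this

/-- The seam has at most `16 S⁴` plaquettes. [folklore] -/
theorem card_seam_le (S R : ℕ) [NeZero S] : ((seam S R).card : ℝ) ≤ 16 * (S : ℝ) ^ 4 :=
  le_trans (by exact_mod_cast Finset.card_le_univ _) (card_plaquette_le S)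

end Count

section Decoupling

variable {G : Type} [Group G] [TopologicalSpace G] [IsTopologicalGroup G] [CompactSpace G] [MeasurableSpace G] [BorelSpace G]
  (r : LatticeRep G) (sch : SpeciesScheme (YMSpecies G))

/-- **Torus minus free cube for the swap Gram pairing**: a uniform bound `ε` on the one-plaquette boundary influences of the seam of `Q_{R_k}`
on the swap product of the family at step `k` gives `|gramPairing − cubeGramPairing| ≤ #seam_k · ε`. [cite: OsterwalderSeiler1978, §3] -/
theorem abs_gramPairing_sub_cubeGramPairing_le (R : ℕ → ℕ) (F : ReflectedFamily) (k : ℕ) {ε : ℝ}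
    (hε : ∀ (A : Finset (Plaquette 4 (sch.side k))) (p : Plaquette 4 (sch.side k)),
      A ⊆ seam (sch.side k) (R k) → p ∈ seam (sch.side k) (R k) → p ∉ A →
        |seamInfluence r.ρ (sch.β k) (sch.side k) (R k) A p (swapProduct r sch F k)| ≤ ε) :
    |gramPairing r sch F k - cubeGramPairing r sch R F k| ≤ (seam (sch.side k) (R k)).card * ε := by
  haveI : SecondCountableTopology G :=
    (r.continuous.isClosedEmbedding r.injective).isEmbedding.secondCountableTopology
  rw [gramPairing_eq_integral_famObs_swap r sch F k, cubeGramPairing_eq_integral_famObs_swap r sch R F k]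
  exact abs_integral_wilson_sub_integral_cube_le r.ρ r.continuous (sch.β k) (R k) (swapProduct r sch F k) hε

/-- ★ **`CubeDecoupling` from the quantitative letter, intended instance `R = L`** (p-C3: the seam is the set of plaquettes wrapping around
the torus): `SeamInfluenceDecay r sch sch.L m` and `SideGrowth sch` give `CubeDecoupling r sch sch.L` —
`|gram − cubeGram| ≤ 16 side_k⁴ · |K| a_k^{−P} e^{−m(a_k L_k − D)} → 0`. [cite: OsterwalderSeiler1978, §3–4] -/
theorem cubeDecoupling_of_seamInfluenceDecay {m : ℝ} (hdec : SeamInfluenceDecay r sch sch.L m) (hside : SideGrowth sch) :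
    CubeDecoupling r sch sch.L := by
  obtain ⟨hm, hF⟩ := hdec
  intro F hdisj
  obtain ⟨K, D, P, hK⟩ := hF F hdisj
  -- scheme asymptotics
  have ha1 : ∀ᶠ k in atTop, sch.a k ≤ 1 :=
    ((tendsto_order.1 sch.tendsto_a).2 1 one_pos).mono fun k hk => hk.le
  -- the dominating penalty sequence
  set ε : ℕ → ℝ := fun k => (16 * |K| * Real.exp (m * D + m)) * ((sch.a k)⁻¹ ^ (P + 4) * (sch.a k * sch.side k) ^ 4 *
    Real.exp (-(m / 2 * (sch.a k * sch.side k)))) with hε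
  have hεt : Tendsto ε atTop (𝓝 0) := tendsto_penalty_zero sch hside _ (m / 2) (half_pos hm) (P + 4) 4
  rw [tendsto_zero_iff_norm_tendsto_zero]
  refine squeeze_zero' (Eventually.of_forall fun k => norm_nonneg _) ?_ hεt
  filter_upwards [hK, ha1] with k hKk ha1k
  rw [Real.norm_eq_abs]
  have ha0 : 0 < sch.a k := sch.a_pos k
  have hS : (sch.side k : ℝ) = 2 * sch.L k + 1 := by simp only [SpeciesScheme.side]; push_cast; ring
  have haL : sch.a k * sch.L k = (sch.a k * sch.side k - sch.a k) / 2 := by rw [hS]; ring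
  -- the uniform influence bound at step `k`
  have hbd := abs_gramPairing_sub_cubeGramPairing_le r sch sch.L F k hKk
  have hcard := card_seam_le (sch.side k) (sch.L k)
  have hcard0 : (0 : ℝ) ≤ (seam (sch.side k) (sch.L k)).card := Nat.cast_nonneg _
  set b : ℝ := K * (sch.a k)⁻¹ ^ P * Real.exp (-(m * (sch.a k * sch.L k - D))) with hb
  have habs : |b| = |K| * (sch.a k)⁻¹ ^ P * Real.exp (-(m * (sch.a k * sch.L k - D))) := by
    rw [hb, abs_mul, abs_mul, abs_of_nonneg (pow_nonneg (inv_nonneg.2 ha0.le) P), Real.abs_exp]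
  have hexp : Real.exp (-(m * (sch.a k * sch.L k - D))) ≤
      Real.exp (m * D + m) * Real.exp (-(m / 2 * (sch.a k * sch.side k))) := by
    rw [← Real.exp_add, Real.exp_le_exp, haL]
    nlinarith [hm, ha1k, ha0]
  have hS4 : (sch.side k : ℝ) ^ 4 = (sch.a k * sch.side k) ^ 4 * (sch.a k)⁻¹ ^ 4 := by
    rw [mul_pow, inv_pow]
    field_simp
  calc |gramPairing r sch F k - cubeGramPairing r sch sch.L F k|
      ≤ (seam (sch.side k) (sch.L k)).card * b := hbd
    _ ≤ (seam (sch.side k) (sch.L k)).card * |b| := mul_le_mul_of_nonneg_left (le_abs_self b) hcard0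
    _ ≤ (16 * (sch.side k : ℝ) ^ 4) * |b| := mul_le_mul_of_nonneg_right hcard (abs_nonneg b)
    _ ≤ (16 * (sch.side k : ℝ) ^ 4) *
          (|K| * (sch.a k)⁻¹ ^ P * (Real.exp (m * D + m) * Real.exp (-(m / 2 * (sch.a k * sch.side k))))) := by
        rw [habs]
        exact mul_le_mul_of_nonneg_left (mul_le_mul_of_nonneg_left hexp (by positivity)) (by positivity)
    _ = ε k := by
        simp only [hε, hS4, pow_add]
        ring

/-- **An admissible cube decoupling from the letter** (`R = L`: `R_k ≤ L_k` trivially, `a_k L_k → ∞` is the scheme axiom). -/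
theorem admissibleCubeDecoupling_of_seamInfluenceDecay {m : ℝ} (hdec : SeamInfluenceDecay r sch sch.L m) (hside : SideGrowth sch) :
    AdmissibleCubeDecoupling r sch :=
  ⟨sch.L, fun _ => le_rfl, sch.tendsto_L, cubeDecoupling_of_seamInfluenceDecay r sch hdec hside⟩

/-- ★ **The D1′ socket from the door-C quantitative letter**: weak coupling, the scheme clause `SideGrowth` and `SeamInfluenceDecay r sch sch.L m`
give `OddTorusSwapPairingLiminf r sch` (✓p828702 `oddTorusSwapPairingLiminf_of_cubeDecoupling`, resting on the landed free-cube swap-RP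
`cubeHalfRP`). [cite: FrohlichIsraelLiebSimon1978, Thm. 2.1] -/
theorem oddTorusSwapPairingLiminf_of_seamInfluenceDecay {m : ℝ} (hw : sch.HasWeakCouplingLimit) (hside : SideGrowth sch)
    (hdec : SeamInfluenceDecay r sch sch.L m) : OddTorusSwapPairingLiminf r sch :=
  oddTorusSwapPairingLiminf_of_cubeDecoupling r sch hw (admissibleCubeDecoupling_of_seamInfluenceDecay r sch hdec hside)

/-- **D1′ (`stub_oddTorusSwapPairingLiminf` of `Cruxes/WeakCouplingHypercubicLimitRP/Lines/Sketch.lean`, ρ1 v2) modulo door C's quantitative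
letter** — D1′'s EXACT binder list followed by ONE hypothesis `SeamInfluenceDecay r (subseq sch φ hφ) (subseq sch φ hφ).L m` implies D1′'s
conclusion (the scheme clause `SideGrowth` of the sub-scheme comes from D1′'s own binders `PolyRenorm ∧ UniformFunctionalBoundPlanes ∧ PolyVolume`
via ✓`growth_subseq_of_polyRenorm_of_ufbPlanes`). [cite: FrohlichIsraelLiebSimon1978, Thm. 2.1] -/
theorem stub_oddTorusSwapPairingLiminf_of_seamInfluenceDecay :
    ∀ (G : Type) [Group G] [TopologicalSpace G] [IsTopologicalGroup G] [CompactSpace G]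
      [MeasurableSpace G] [BorelSpace G] (r : LatticeRep G) (sch : SpeciesScheme (YMSpecies G))
      (φ : ℕ → ℕ) (hφ : StrictMono φ)
      (T : (n : ℕ) → (Fin n → Plane) → (𝓢((Fin n → EuclideanSpace ℝ (Fin 4)), ℂ) →L[ℂ] ℂ)),
      sch.HasWeakCouplingLimit → PolyVolume sch → PolyRenorm r sch → UniformFunctionalBoundPlanes r sch →
        (∃ Δ C : ℝ, 0 < Δ ∧ RPSpectral r sch Δ C) → PlaneLimits r sch φ T →
        ∀ m : ℝ, SeamInfluenceDecay r (subseq sch φ hφ) (subseq sch φ hφ).L m →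
          OddTorusSwapPairingLiminf r (subseq sch φ hφ) := by
  intro G _ _ _ _ _ _ r sch φ hφ T hw hV hc hU _ _ m hdec
  exact oddTorusSwapPairingLiminf_subseq_of_cubeDecoupling r sch φ hφ hw
    (admissibleCubeDecoupling_of_seamInfluenceDecay r (subseq sch φ hφ) hdec
      (growth_subseq_of_polyRenorm_of_ufbPlanes r sch hc hU hV φ hφ).2)

end Decoupling

end Summit.QuantumFields.YangMills.Cruxes.DiagonalMirrorRPR.CubeSurgery

end
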